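import Mathlib
import Summits.NavierStokesRegularity.NavierStokesRegularity.Theses.EulerZoomLiouville
import Summits.NavierStokesRegularity.NavierStokesRegularity.Theorems.EulerZoomLiouvillePowerGaugeEulerLiouvilleSelfSimilarVorticalEscape
import Summits.NavierStokesRegularity.NavierStokesRegularity.Theorems.EulerZoomLiouvillePowerGaugeEulerLiouvilleSelfSimilarBernoulliFeeding
import Summits.NavierStokesRegularity.NavierStokesRegularity.Theorems.EulerZoomLiouvillePowerGaugeEulerLiouvilleSelfSimilarHalfOrbitKit
import Summits.NavierStokesRegularity.NavierStokesRegularity.Theorems.EulerZoomLiouvillePowerGaugeEulerLiouvilleActionCreepMaximisers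
import Summits.NavierStokesRegularity.NavierStokesRegularity.Theorems.EulerZoomLiouvillePowerGaugeEulerLiouvilleActionCreepFilament
import Literature.Analysis.FluidPDE.DecayingSelfSimilarEulerProfile
import Literature.Analysis.FluidPDE.VectorCalculus
import HarnessLib.Audit

/-!
# Line `action_creep` — THE ACTION BUDGET OF NEAR-MAXIMAL LABELS (ns-idea-11 g8, LINE g8-1; lens «complete» ∘ «control»)

Crux `EulerZoomLiouville.PowerGaugeEulerLiouville` = stmt-NavierStokesRegularity-19832, registered residue
`Birth.stub_selfSimilarC2Needle` (THE ONE STATEMENT, `Lines/birth.lean` ★ v97 sha16 91de548d22b22677, LEAD ns-typeII-p2 g14).  Files only: this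
line composes BY NAME to the verbatim copy `Sig.stub_selfSimilarC2Needle` below (all shared predicates character-identical to v97, script-checked — REV3
re-copy (`HasResidenceClock` NINE alternatives, alt 9 = «spikes or hovering» = line last_exit member, ns-ezl-w3 p682182); REV1 re-copy from v89; REV1 STATUS: AC1 `stub_creepingMaximisers` is the TREE THEOREM `ActionCreep.creepingMaximisers` (ns-ezl-w3 g6 p680489), wired by `exact`;
REV2: filament forms AC1′ (PROVABLE L) / AC2′ (OPEN) per critic V84 P2; REV3: AC1′ `stub_creepingFilament` is the TREE THEOREM
`ActionCreep.creepingFilament` (ns-ezl-w3 g6 p683438), wired by name ⇒ sorries = exactly the two OPEN faces AC2′ `stub_filamentFace`, AC3 `stub_blazeFace`);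
it never touches `Lines/birth.lean`.  No summit is proved by a line; 19832 is OPEN; NS regularity is NOT proved.

## The lever (one sentence)
Along a backward similarity orbit the Bernoulli function GAINS exactly the ACTION, `ℋ(Y σ) − ℋ(Y 0) = (1−2γ)∫₀^σ ‖W(Y t)‖² dt`
(CIV (3.31), tree `Loc.bernoulli_comp_sub_eq_of_Ici`); so a vortical label whose Bernoulli value is within `δ` of the SUPREMUM
of `ℋ` over the vortical set has a lifetime action budget `≤ δ/(1−2γ)` — it CREEPS: it still comes from infinity
(`Loc.ae_not_boundedBackward_of_curl_ne_zero`) but is `η`-hovering (`‖W‖ ≤ η`) off a time set of measure `≤ δ/((1−2γ)η²)` and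
of total length `≤ δ/((1−2γ)η)`.  This is the LEAD's lesson «integrate the per-radius witnesses along the radial parameter»
applied to the one quantity that integrates exactly: the action.

## The dichotomy it types (new: CANONICAL hovering)
For a classical pressure `P′` of the `C²` profile let `M_∞ := sup {ℋ_{P′}(y) : curl V y ≠ 0} ∈ (−∞, +∞]`.
* BOUNDED BRANCH `M_∞ < ∞` (allowed by `¬ HasTameVorticalBernoulli` exactly when the far vortical field is PRESSURISED and the
  strain excess is untame): `stub_creepingMaximisers` (PROVABLE, stated class-free) — beyond every radius there are vortical
  points with `ℋ > M_∞ − δ` and `‖W‖ ≤ δ`; by the closed REV6 lemma `NeedleFaces.Residue.pressure_gt_of_high_of_hovering` they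
  carry STAGNATION-LEVEL pressure `P′ > M_∞ − δ − ½δ² + ½γ(1−γ)‖y‖²`.  So in the bounded branch the LEAD's condenser face T-E
  (RESIDUE-MEMO-19832-g13 §4: «hovering near similarity stagnation») is not one alternative among others but CANONICAL and
  QUANTIFIED: the near-maximal labels form an OPEN far set all of whose backward orbits creep with arbitrarily small action.
  The open face of this branch is `stub_creepFace` («far near-maximal vortical points do not hover») = T-E restricted to
  near-maximal labels, with the action budget as the new handle.
* BLAZING BRANCH `M_∞ = +∞`: the generic needle (`ℋ ≈ ½‖W‖² − ½γ(1−γ)R² + P′ → +∞` along fast unpressurised jets).  NOT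
  attacked by this line; typed as `stub_blazeFace` only so that the composition below is kernel-checked and the branch point
  is explicit.  (Honest label: `stub_blazeFace` is the blazing needle itself.)

## Closed content (0 sorry): the static twin of the lever — «NEAR-CRITICAL ⇒ NEAR-STAGNANT»
From the Bernoulli form `∇ℋ = (2γ−1)W − Ω × W` (Literature `IsSelfSimilarEulerProfile.gradient_selfSimilarBernoulli`,
CIV (3.29)) and `Ω × W ⊥ W`: `Lamb.sq_norm_gradient_eq` `‖∇ℋ‖² = (1−2γ)²‖W‖² + ‖Ω × W‖²`, hence `Lamb.speed_le_norm_gradient`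
`(1−2γ)‖W‖ ≤ ‖∇ℋ‖` (an `ε`-critical point of `ℋ` is `ε/(1−2γ)`-stagnant — Ekeland's principle turns near-maximisers into
near-critical points; the dynamic proof of `stub_creepingMaximisers` avoids the irrotational-neighbour caveat) and
`Lamb.norm_gradient_le` `‖∇ℋ‖ ≤ ‖W‖(‖Ω‖ + (1−2γ))` (FLANK VORTICITY FLOOR: a Bernoulli drop `D` across width `w` at speed `s`
forces `‖Ω‖ ≥ D/(ws) − (1−2γ)` somewhere on the flank — the Bernoulli reading of the condenser margin `R^{3−ρ}`, card §Barriers).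

## Stubs (sorries = stubs; BY-NAME tools a prover needs are named in each docstring)
* `stub_creepingMaximisers` — CLOSED (REV1: tree theorem `ActionCreep.creepingMaximisers`, ns-ezl-w3 g6 p680489; was PROVABLE L): feeding/escape (`Loc.exists_inflow_vortical_bernoulli_gt`,
  `Loc.ae_not_boundedBackward_of_curl_ne_zero`), the half-orbit Bernoulli identity (`Loc.bernoulli_comp_sub_eq_of_Ici`),
  transport of vanishing vorticity (Cauchy formula, as in `…SelfSimilarBernoulliFeeding`), `ℋ ≤ M_∞` on vortical points.
* REV2 (critic V84 P2 «make the budget bite»): `stub_creepingFilament` (AC1′) — CLOSED in REV3 (tree theorem `ActionCreep.creepingFilament`, ns-ezl-w3 g6 p683438; companion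
  `ActionCreep.volume_speed_ge_le_of_action` = the Chebyshev hover-time bound «non-hovering times ≤ δ/η²», `…ActionCreepHoverTime`); was PROVABLE (L; the ORBIT form of AC1: a CREEPING
  FILAMENT = a global, unbounded, vortical backward orbit starting beyond `R₀` at level `> M_∞ − δ` with total action `≤ δ`; same proof as
  AC1 with the orbit retained and shifted to a far time) and `stub_filamentFace` (AC2′) — OPEN (XL; AC2 WEAKENED: it forbids creeping
  FILAMENTS — objects the set-integrated laws (F)/(K)/E-gauge can act on — instead of single hovering points).  The REV0 Sig
  `Sig.stub_creepFace` (hovering-POINT form; critic: «bounded-branch needle, hovering-point form, width 0») is kept for the record and still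
  feeds the REV0 composition as a hypothesis; it is no longer a stub.  * `stub_blazeFace` — OPEN (the blazing needle; not attacked; critic:
  «residual complement»).
* Compositions (kernel-checked, no sorry): REV2 `boundedBranch_of_filament` / `selfSimilarC2Needle_of_filament :
  stub_creepingFilament → stub_filamentFace → stub_blazeFace → Sig.stub_selfSimilarC2Needle`; REV0 `boundedBranch_of` /
  `selfSimilarC2Needle_of` (through `Sig.stub_creepFace`).
* Critic V84 P3 (recorded): `M_∞` depends on the classical pressure only through an additive constant, so BOUNDED/BLAZING is a property of
  `V`; P4 (question → LEAD): is the pressurised parked cell of RESIDUE-MEMO §2 T2 / §4 T-E a bounded-branch object?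
No summit is proved by a line; DENT 0; 19832 OPEN.
-/

open MeasureTheory Set Filter Topology Metric
open scoped ENNReal NNReal ContDiff

set_option linter.dupNamespace false

namespace Summit.NavierStokesRegularity.NavierStokesRegularity.Cruxes.PowerGaugeEulerLiouville.ActionCreep

/-- Local abbreviation: ℝ³ (verbatim `Birth.E3`). -/
abbrev E3 : Type := EuclideanSpace ℝ (Fin 3)

/-- Membership in Seregin's power-gauged ancient Euler class (verbatim `Birth.InClass`, `Lines/birth.lean` v78). -/
@[reducible] def InClass (ρ : ℝ) (u : ℝ → E3 → E3) (p : ℝ → E3 → ℝ) (H : ℝ → E3 → E3 →L[ℝ] E3)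
    (c : ℝ≥0) : Prop :=
  Literature.Analysis.FluidPDE.IsSuitableWeakSolutionOn
      (Literature.Analysis.FluidPDE.slab (EuclideanSpace ℝ (Fin 3)) (Set.Iio 0) isOpen_Iio) 0 0 u p ∧
    Literature.Analysis.FluidPDE.HasWeakSpatialGradientOn
      (Literature.Analysis.FluidPDE.slab (EuclideanSpace ℝ (Fin 3)) (Set.Iio 0) isOpen_Iio) u H ∧
    (∀ a : ℝ, 0 < a →
      ENNReal.ofReal (a ^ (2 * ρ)) * Literature.Analysis.FluidPDE.cknA a (0 : ℝ × E3) u +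
          ENNReal.ofReal (a ^ ρ) * Literature.Analysis.FluidPDE.cknE a (0 : ℝ × E3) H +
        ENNReal.ofReal (a ^ (2 * ρ)) * Literature.Analysis.FluidPDE.cknD a (0 : ℝ × E3) p ≤ (c : ℝ≥0∞))

/-- Exactly self-similar member about the origin with profile `(V, P)` (verbatim `Birth.IsExactlySelfSimilar`, v78). -/
@[reducible] def IsExactlySelfSimilar (ρ : ℝ) (u : ℝ → E3 → E3) (p : ℝ → E3 → ℝ) (V : E3 → E3) (P : E3 → ℝ) :
    Prop :=
  (∀ τ : ℝ, τ < 0 → u τ = Literature.Analysis.FluidPDE.selfSimilarCollapse (1 / (2 + ρ)) 0 V τ) ∧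
    (∀ τ : ℝ, τ < 0 → p τ = Literature.Analysis.FluidPDE.selfSimilarCollapsePressure (1 / (2 + ρ)) 0 P τ)

/-- EXTREMAL profile: the `A`-gauge rate is saturated (verbatim `Birth.IsExtremalProfile`, v78). -/
@[reducible] def IsExtremalProfile (ρ : ℝ) (V : E3 → E3) : Prop :=
  ∃ ε : ℝ, 0 < ε ∧ ∃ L₀ : ℝ, ∀ L : ℝ, L₀ ≤ L →
    ε ≤ L ^ (2 * ρ - 1) * ∫ y in Metric.ball (0 : E3) L, ‖V y‖ ^ 2

/-- Bernoulli piercing on spheres beyond every radius (verbatim `Birth.HasBernoulliPiercing`, v78). -/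
@[reducible] def HasBernoulliPiercing (ρ : ℝ) (V : E3 → E3) : Prop :=
  ∀ P' : E3 → ℝ, Literature.Analysis.FluidPDE.IsSelfSimilarEulerProfile (1 / (2 + ρ)) 0 V P' →
    ∀ h R₀ : ℝ, ∃ R : ℝ, R₀ ≤ R ∧ ∀ y : E3, ‖y‖ = R →
      inner ℝ y (V y) ≤ -(1 / (2 + ρ) * ‖y‖ ^ 2) →
        (Literature.Analysis.FluidPDE.curl V y = 0 ∨
          Literature.Analysis.FluidPDE.selfSimilarBernoulli (1 / (2 + ρ)) 0 V P' y < h)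

/-- FAST VORTICAL CHANNEL in one of TWELVE killed senses (verbatim `Birth.HasFastVorticalChannel`, ★ v97 = v93 text; each clause for EVERY classical `P′` and
level `h`, beyond some radius, on the VORTICAL points of `{ℋ_{P′} > h}` unless said otherwise): (1) ONE-SIDED inflow channel at ANY rate `c₁ > 0` (v83, LEAD g13
`…vorticalChannelC2_profile_anyRate`); (2) INFLOW HALF-BAND DEFICIT (v84, LEAD g13); (3) VIRIAL FORM (v85, ns-ezl-w1 g6); (4) ABSOLUTE INFLOW-BAND DEFICIT
«any inward drift kills» (v86, LEAD g13, POWER clock); (5) h-FREE RADIAL-PRESSURE FORM (v86, ns-sfl-p1 g6); (6) ABSOLUTE VIRIAL form (v87, ns-ezl-w1 g6);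
(7) = (4) with DECAYING floor `a ≥ a₀/‖y‖²` (v87, LEAD g13); (8) ABSOLUTE RADIAL-PRESSURE FORM (v89, ns-sfl-p1 g6); (9) rpow POWER BAND `0 ≤ e₁ < ρ`,
`0 ≤ e₂ < 2+ρ+e₁` (v89, ns-ezl-w1 g6); (10) INVARIANT-REGION band deficit (v90, ns-ezl-w1 g6 `…invariantBandDeficitC2_profile`); (11) POWER BAND DEFICIT AT
ONE LEVEL below ONE vortical point (v91, ns-ezl-w1 g6 `…powerBandDeficitC2_level`); (12) = (10) with the deficit allowed to FAIL on an exceptional set that a.e.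
backward arc of the invariant region AVOIDS (v93, LEAD g14 ← ns-ezl-w1 g6 T-I `…avoidingBandDeficitC2_profile`). -/
@[reducible] def HasFastVorticalChannel (ρ : ℝ) (V : E3 → E3) : Prop :=
  (∃ c₁ : ℝ, 0 < c₁ ∧
    ∀ P' : E3 → ℝ, Literature.Analysis.FluidPDE.IsSelfSimilarEulerProfile (1 / (2 + ρ)) 0 V P' →
      ∀ h : ℝ, ∃ R₀ : ℝ, ∀ y : E3, R₀ ≤ ‖y‖ → h < Literature.Analysis.FluidPDE.selfSimilarBernoulli (1 / (2 + ρ)) 0 V P' y →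
        Literature.Analysis.FluidPDE.curl V y ≠ 0 →
          inner ℝ y (Literature.Analysis.FluidPDE.selfSimilarTransport (1 / (2 + ρ)) 0 V y) ≤ -(c₁ * ‖y‖ ^ 2)) ∨
  (∃ c₁ μ : ℝ, 0 < c₁ ∧ 0 < μ ∧
    ∀ P' : E3 → ℝ, Literature.Analysis.FluidPDE.IsSelfSimilarEulerProfile (1 / (2 + ρ)) 0 V P' →
      ∀ h : ℝ, ∃ R₀ : ℝ, ∀ y : E3, R₀ ≤ ‖y‖ → h < Literature.Analysis.FluidPDE.selfSimilarBernoulli (1 / (2 + ρ)) 0 V P' y →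
        Literature.Analysis.FluidPDE.curl V y ≠ 0 →
          -(c₁ * ‖y‖ ^ 2) ≤ inner ℝ y (Literature.Analysis.FluidPDE.selfSimilarTransport (1 / (2 + ρ)) 0 V y) →
          inner ℝ y (Literature.Analysis.FluidPDE.selfSimilarTransport (1 / (2 + ρ)) 0 V y) ≤ 0 →
          (2 * c₁ ^ 2 + μ) * ‖y‖ ^ 2 ≤ ‖Literature.Analysis.FluidPDE.selfSimilarTransport (1 / (2 + ρ)) 0 V y‖ ^ 2 +
            (1 / (2 + ρ)) * inner ℝ y (Literature.Analysis.FluidPDE.selfSimilarTransport (1 / (2 + ρ)) 0 V y) +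
            inner ℝ y (fderiv ℝ V y (Literature.Analysis.FluidPDE.selfSimilarTransport (1 / (2 + ρ)) 0 V y))) ∨
  (∃ c₁ μ : ℝ, 0 < c₁ ∧ 0 < μ ∧
    ∀ P' : E3 → ℝ, Literature.Analysis.FluidPDE.IsSelfSimilarEulerProfile (1 / (2 + ρ)) 0 V P' →
      ∀ h : ℝ, ∃ R₀ : ℝ, ∀ y : E3, R₀ ≤ ‖y‖ → h < Literature.Analysis.FluidPDE.selfSimilarBernoulli (1 / (2 + ρ)) 0 V P' y →
        Literature.Analysis.FluidPDE.curl V y ≠ 0 →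
          -(c₁ * ‖y‖ ^ 2) ≤ inner ℝ y (Literature.Analysis.FluidPDE.selfSimilarTransport (1 / (2 + ρ)) 0 V y) →
          inner ℝ y (Literature.Analysis.FluidPDE.selfSimilarTransport (1 / (2 + ρ)) 0 V y) ≤ 0 →
          2 * P' y + inner ℝ y (gradient P' y) ≤ 2 * h + (2 * (1 / (2 + ρ)) * (1 - 1 / (2 + ρ)) - 2 * c₁ ^ 2 - μ) * ‖y‖ ^ 2) ∨
  (∃ κb a₀ : ℝ, 0 < κb ∧ 0 < a₀ ∧
    ∀ P' : E3 → ℝ, Literature.Analysis.FluidPDE.IsSelfSimilarEulerProfile (1 / (2 + ρ)) 0 V P' →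
      ∀ h : ℝ, ∃ R₀ : ℝ, ∀ y : E3, R₀ ≤ ‖y‖ → h < Literature.Analysis.FluidPDE.selfSimilarBernoulli (1 / (2 + ρ)) 0 V P' y →
        Literature.Analysis.FluidPDE.curl V y ≠ 0 →
          -κb ≤ inner ℝ y (Literature.Analysis.FluidPDE.selfSimilarTransport (1 / (2 + ρ)) 0 V y) →
          inner ℝ y (Literature.Analysis.FluidPDE.selfSimilarTransport (1 / (2 + ρ)) 0 V y) ≤ 0 →
          a₀ ≤ ‖Literature.Analysis.FluidPDE.selfSimilarTransport (1 / (2 + ρ)) 0 V y‖ ^ 2 +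
            (1 / (2 + ρ)) * inner ℝ y (Literature.Analysis.FluidPDE.selfSimilarTransport (1 / (2 + ρ)) 0 V y) +
            inner ℝ y (fderiv ℝ V y (Literature.Analysis.FluidPDE.selfSimilarTransport (1 / (2 + ρ)) 0 V y))) ∨
  (∃ c₁ μ : ℝ, 0 < c₁ ∧ 0 < μ ∧
    ∀ P' : E3 → ℝ, Literature.Analysis.FluidPDE.IsSelfSimilarEulerProfile (1 / (2 + ρ)) 0 V P' →
      ∀ h : ℝ, ∃ R₀ : ℝ, ∀ y : E3, R₀ ≤ ‖y‖ → h < Literature.Analysis.FluidPDE.selfSimilarBernoulli (1 / (2 + ρ)) 0 V P' y →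
        Literature.Analysis.FluidPDE.curl V y ≠ 0 →
          -(c₁ * ‖y‖ ^ 2) ≤ inner ℝ y (Literature.Analysis.FluidPDE.selfSimilarTransport (1 / (2 + ρ)) 0 V y) →
          inner ℝ y (Literature.Analysis.FluidPDE.selfSimilarTransport (1 / (2 + ρ)) 0 V y) ≤ 0 →
          inner ℝ y (gradient P' y) ≤ ‖Literature.Analysis.FluidPDE.selfSimilarTransport (1 / (2 + ρ)) 0 V y‖ ^ 2 +
            ((1 / (2 + ρ)) * (1 - 1 / (2 + ρ)) - 2 * c₁ ^ 2 - μ) * ‖y‖ ^ 2) ∨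
  (∃ κb a₀ : ℝ, 0 < κb ∧ 0 < a₀ ∧
    ∀ P' : E3 → ℝ, Literature.Analysis.FluidPDE.IsSelfSimilarEulerProfile (1 / (2 + ρ)) 0 V P' →
      ∀ h : ℝ, ∃ R₀ : ℝ, ∀ y : E3, R₀ ≤ ‖y‖ → h < Literature.Analysis.FluidPDE.selfSimilarBernoulli (1 / (2 + ρ)) 0 V P' y →
        Literature.Analysis.FluidPDE.curl V y ≠ 0 →
          -κb ≤ inner ℝ y (Literature.Analysis.FluidPDE.selfSimilarTransport (1 / (2 + ρ)) 0 V y) →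
          inner ℝ y (Literature.Analysis.FluidPDE.selfSimilarTransport (1 / (2 + ρ)) 0 V y) ≤ 0 →
          2 * P' y + inner ℝ y (gradient P' y) ≤ 2 * h + 2 * (1 / (2 + ρ)) * (1 - 1 / (2 + ρ)) * ‖y‖ ^ 2 - a₀) ∨
  (∃ κb a₀ : ℝ, 0 < κb ∧ 0 < a₀ ∧
    ∀ P' : E3 → ℝ, Literature.Analysis.FluidPDE.IsSelfSimilarEulerProfile (1 / (2 + ρ)) 0 V P' →
      ∀ h : ℝ, ∃ R₀ : ℝ, ∀ y : E3, R₀ ≤ ‖y‖ → h < Literature.Analysis.FluidPDE.selfSimilarBernoulli (1 / (2 + ρ)) 0 V P' y →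
        Literature.Analysis.FluidPDE.curl V y ≠ 0 →
          -κb ≤ inner ℝ y (Literature.Analysis.FluidPDE.selfSimilarTransport (1 / (2 + ρ)) 0 V y) →
          inner ℝ y (Literature.Analysis.FluidPDE.selfSimilarTransport (1 / (2 + ρ)) 0 V y) ≤ 0 →
          a₀ / ‖y‖ ^ 2 ≤ ‖Literature.Analysis.FluidPDE.selfSimilarTransport (1 / (2 + ρ)) 0 V y‖ ^ 2 +
            (1 / (2 + ρ)) * inner ℝ y (Literature.Analysis.FluidPDE.selfSimilarTransport (1 / (2 + ρ)) 0 V y) +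
            inner ℝ y (fderiv ℝ V y (Literature.Analysis.FluidPDE.selfSimilarTransport (1 / (2 + ρ)) 0 V y))) ∨
  (∃ κb a₀ : ℝ, 0 < κb ∧ 0 < a₀ ∧
    ∀ P' : E3 → ℝ, Literature.Analysis.FluidPDE.IsSelfSimilarEulerProfile (1 / (2 + ρ)) 0 V P' →
      ∀ h : ℝ, ∃ R₀ : ℝ, ∀ y : E3, R₀ ≤ ‖y‖ → h < Literature.Analysis.FluidPDE.selfSimilarBernoulli (1 / (2 + ρ)) 0 V P' y →
        Literature.Analysis.FluidPDE.curl V y ≠ 0 →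
          -κb ≤ inner ℝ y (Literature.Analysis.FluidPDE.selfSimilarTransport (1 / (2 + ρ)) 0 V y) → inner ℝ y (Literature.Analysis.FluidPDE.selfSimilarTransport (1 / (2 + ρ)) 0 V y) ≤ 0 →
          inner ℝ y (gradient P' y) ≤ ‖Literature.Analysis.FluidPDE.selfSimilarTransport (1 / (2 + ρ)) 0 V y‖ ^ 2 +
            (1 / (2 + ρ)) * (1 - 1 / (2 + ρ)) * ‖y‖ ^ 2 - a₀) ∨
  (∃ κb a₀ e₁ e₂ : ℝ, 0 < κb ∧ 0 < a₀ ∧ 0 ≤ e₁ ∧ e₁ < ρ ∧ 0 ≤ e₂ ∧ e₂ < 2 + ρ + e₁ ∧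
    ∀ P' : E3 → ℝ, Literature.Analysis.FluidPDE.IsSelfSimilarEulerProfile (1 / (2 + ρ)) 0 V P' →
      ∀ h : ℝ, ∃ R₀ : ℝ, ∀ y : E3, R₀ ≤ ‖y‖ → h < Literature.Analysis.FluidPDE.selfSimilarBernoulli (1 / (2 + ρ)) 0 V P' y →
        Literature.Analysis.FluidPDE.curl V y ≠ 0 →
          -(κb * ‖y‖ ^ (-e₁)) ≤ inner ℝ y (Literature.Analysis.FluidPDE.selfSimilarTransport (1 / (2 + ρ)) 0 V y) → inner ℝ y (Literature.Analysis.FluidPDE.selfSimilarTransport (1 / (2 + ρ)) 0 V y) ≤ 0 →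
          a₀ * ‖y‖ ^ (-e₂) ≤ ‖Literature.Analysis.FluidPDE.selfSimilarTransport (1 / (2 + ρ)) 0 V y‖ ^ 2 +
            (1 / (2 + ρ)) * inner ℝ y (Literature.Analysis.FluidPDE.selfSimilarTransport (1 / (2 + ρ)) 0 V y) +
            inner ℝ y (fderiv ℝ V y (Literature.Analysis.FluidPDE.selfSimilarTransport (1 / (2 + ρ)) 0 V y))) ∨
  (∀ P' : E3 → ℝ, Literature.Analysis.FluidPDE.IsSelfSimilarEulerProfile (1 / (2 + ρ)) 0 V P' →
      ∃ O : Set E3, IsOpen O ∧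
        (∀ (Z : ℝ → E3) (t : ℝ), 0 ≤ t →
          (∀ s ∈ Set.Icc 0 t, HasDerivAt Z (-(Literature.Analysis.FluidPDE.selfSimilarTransport (1 / (2 + ρ)) 0 V (Z s))) s) → Z 0 ∈ O → Z t ∈ O) ∧
        (∃ x₁ ∈ O, Literature.Analysis.FluidPDE.curl V x₁ ≠ 0) ∧
        ∃ κb a₀ e₁ e₂ Rf : ℝ, 0 < κb ∧ 0 < a₀ ∧ 0 ≤ e₁ ∧ e₁ < ρ ∧ 0 ≤ e₂ ∧ e₂ < 2 + ρ + e₁ ∧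
          ∀ y ∈ O, Rf ≤ ‖y‖ → Literature.Analysis.FluidPDE.curl V y ≠ 0 →
            -(κb * ‖y‖ ^ (-e₁)) ≤ inner ℝ y (Literature.Analysis.FluidPDE.selfSimilarTransport (1 / (2 + ρ)) 0 V y) → inner ℝ y (Literature.Analysis.FluidPDE.selfSimilarTransport (1 / (2 + ρ)) 0 V y) ≤ 0 →
            a₀ * ‖y‖ ^ (-e₂) ≤ ‖Literature.Analysis.FluidPDE.selfSimilarTransport (1 / (2 + ρ)) 0 V y‖ ^ 2 +
              (1 / (2 + ρ)) * inner ℝ y (Literature.Analysis.FluidPDE.selfSimilarTransport (1 / (2 + ρ)) 0 V y) +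
              inner ℝ y (fderiv ℝ V y (Literature.Analysis.FluidPDE.selfSimilarTransport (1 / (2 + ρ)) 0 V y))) ∨
  (∃ κb a₀ e₁ e₂ : ℝ, 0 < κb ∧ 0 < a₀ ∧ 0 ≤ e₁ ∧ e₁ < ρ ∧ 0 ≤ e₂ ∧ e₂ < 2 + ρ + e₁ ∧
    ∀ P' : E3 → ℝ, Literature.Analysis.FluidPDE.IsSelfSimilarEulerProfile (1 / (2 + ρ)) 0 V P' →
      ∃ x₁ : E3, Literature.Analysis.FluidPDE.curl V x₁ ≠ 0 ∧ ∃ h : ℝ, h < Literature.Analysis.FluidPDE.selfSimilarBernoulli (1 / (2 + ρ)) 0 V P' x₁ ∧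
        ∃ R₀ : ℝ, ∀ y : E3, R₀ ≤ ‖y‖ → h < Literature.Analysis.FluidPDE.selfSimilarBernoulli (1 / (2 + ρ)) 0 V P' y →
          Literature.Analysis.FluidPDE.curl V y ≠ 0 →
            -(κb * ‖y‖ ^ (-e₁)) ≤ inner ℝ y (Literature.Analysis.FluidPDE.selfSimilarTransport (1 / (2 + ρ)) 0 V y) → inner ℝ y (Literature.Analysis.FluidPDE.selfSimilarTransport (1 / (2 + ρ)) 0 V y) ≤ 0 →
            a₀ * ‖y‖ ^ (-e₂) ≤ ‖Literature.Analysis.FluidPDE.selfSimilarTransport (1 / (2 + ρ)) 0 V y‖ ^ 2 +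
              (1 / (2 + ρ)) * inner ℝ y (Literature.Analysis.FluidPDE.selfSimilarTransport (1 / (2 + ρ)) 0 V y) +
              inner ℝ y (fderiv ℝ V y (Literature.Analysis.FluidPDE.selfSimilarTransport (1 / (2 + ρ)) 0 V y))) ∨
  (∀ P' : E3 → ℝ, Literature.Analysis.FluidPDE.IsSelfSimilarEulerProfile (1 / (2 + ρ)) 0 V P' →
      ∃ O : Set E3, IsOpen O ∧
        (∀ (Z : ℝ → E3) (t : ℝ), 0 ≤ t →
          (∀ s ∈ Set.Icc 0 t, HasDerivAt Z (-(Literature.Analysis.FluidPDE.selfSimilarTransport (1 / (2 + ρ)) 0 V (Z s))) s) → Z 0 ∈ O → Z t ∈ O) ∧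
        (∃ x₁ ∈ O, Literature.Analysis.FluidPDE.curl V x₁ ≠ 0) ∧
        ∃ E : Set E3,
          (∀ᵐ y ∂(volume : Measure E3), y ∈ O →
            ∀ (Z : ℝ → E3) (t : ℝ), 0 ≤ t →
              (∀ s ∈ Set.Icc 0 t, HasDerivAt Z (-(Literature.Analysis.FluidPDE.selfSimilarTransport (1 / (2 + ρ)) 0 V (Z s))) s) → Z 0 = y →
                ∀ s ∈ Set.Icc 0 t, Z s ∉ E) ∧
        ∃ κb a₀ e₁ e₂ Rf : ℝ, 0 < κb ∧ 0 < a₀ ∧ 0 ≤ e₁ ∧ e₁ < ρ ∧ 0 ≤ e₂ ∧ e₂ < 2 + ρ + e₁ ∧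
          ∀ y ∈ O, y ∉ E → Rf ≤ ‖y‖ → Literature.Analysis.FluidPDE.curl V y ≠ 0 →
            -(κb * ‖y‖ ^ (-e₁)) ≤ inner ℝ y (Literature.Analysis.FluidPDE.selfSimilarTransport (1 / (2 + ρ)) 0 V y) → inner ℝ y (Literature.Analysis.FluidPDE.selfSimilarTransport (1 / (2 + ρ)) 0 V y) ≤ 0 →
            a₀ * ‖y‖ ^ (-e₂) ≤ ‖Literature.Analysis.FluidPDE.selfSimilarTransport (1 / (2 + ρ)) 0 V y‖ ^ 2 +
              (1 / (2 + ρ)) * inner ℝ y (Literature.Analysis.FluidPDE.selfSimilarTransport (1 / (2 + ρ)) 0 V y) +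
              inner ℝ y (fderiv ℝ V y (Literature.Analysis.FluidPDE.selfSimilarTransport (1 / (2 + ρ)) 0 V y)))

/-- Residence clock, NINE alternatives (verbatim `Birth.HasResidenceClock`, ★ v97 = v94 text): (1) LOG clock, (2) POWER clock `c′R^{2+ρ}`, (3)/(4) subcritical strain
clocks, (5) the HOVERING LAW with Bernoulli oscillation exponent `θ_ℋ < 2+ρ`, (6) v88 LOCAL power clock — for every `c′ > 0` ONE ball, centre arbitrary (LEAD g13
`NeedleRace.selfSimilar_ae_eq_zero_of_localPowerClockC2`), (7) v91 envelope `θ < 2+ρ` + LOCAL hovering law at ONE ball (LEAD g13 `…localHoveringLawC2`), (8) v92 «no balanced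
perigee ∧ no inflow hovering ∧ no spike above ONE level through ONE vortical point» (ns-ezl-w1 g6 T-D `…perigeeFastEnvelopeC2_level`), (9) v94 «SPIKES OR HOVERING»: no far
hovering above h ∧ no vortical spikes θ < 2+ρ above h through ONE vortical point (ns-ezl-w3 g6 p682182 `LastExit.localPowerClock_of_spikesOrHovering` = line last_exit member). -/
@[reducible] def HasResidenceClock (ρ : ℝ) (V : E3 → E3) : Prop :=
  (∃ s₁ : ℝ, 0 ≤ s₁ ∧ ∀ x₀ : E3, Literature.Analysis.FluidPDE.curl V x₀ ≠ 0 → ∃ r : ℝ, 0 < r ∧ ∃ R₀ : ℝ, ∀ R : ℝ, R₀ ≤ R →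
      ∀ (V' : E3 → E3) (K Rbig : ℝ), ContDiff ℝ 2 V' → (∀ y, ‖fderiv ℝ V' y‖ ≤ K) → 2 * R < Rbig →
        (∀ w ∈ Metric.ball (0 : E3) Rbig, V' w = V w) →
        (volume (Metric.ball x₀ r ∩ {y | ∀ σ ∈ Set.Icc 0 (s₁ * Real.log R),
          ‖Literature.Analysis.ODE.evolutionMap (fun _ : ℝ => Literature.Analysis.FluidPDE.selfSimilarTransport (1 / (2 + ρ)) 0 V') 0 (-σ) y‖ ≤ 2 * R})).toReal ≤
          (volume (Metric.ball x₀ r)).toReal / 2) ∨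
  (∀ c' : ℝ, 0 < c' → ∀ x₀ : E3, Literature.Analysis.FluidPDE.curl V x₀ ≠ 0 → ∃ r : ℝ, 0 < r ∧ ∃ R₀ : ℝ, ∀ R : ℝ, R₀ ≤ R →
      ∀ (V' : E3 → E3) (K Rbig : ℝ), ContDiff ℝ 2 V' → (∀ y, ‖fderiv ℝ V' y‖ ≤ K) → 2 * R < Rbig →
        (∀ w ∈ Metric.ball (0 : E3) Rbig, V' w = V w) →
        (volume (Metric.ball x₀ r ∩ {y | ∀ σ ∈ Set.Icc 0 (c' * R ^ (2 + ρ)),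
          ‖Literature.Analysis.ODE.evolutionMap (fun _ : ℝ => Literature.Analysis.FluidPDE.selfSimilarTransport (1 / (2 + ρ)) 0 V') 0 (-σ) y‖ ≤ 2 * R})).toReal ≤
          (volume (Metric.ball x₀ r)).toReal / 2) ∨
  (∃ s : ℝ, s < 1 ∧ (∀ z v : E3, inner ℝ (fderiv ℝ V z v) v ≤ s * ‖v‖ ^ 2) ∧
    ∀ ε : ℝ, 0 < ε → ∃ R₂ : ℝ, ∀ z : E3, R₂ ≤ ‖z‖ → Real.log ‖Literature.Analysis.FluidPDE.curl V z‖ ≤ ε * ‖z‖ ^ (2 + ρ)) ∨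
  (∃ s : ℝ, s < (1 + 2 * ρ) / (2 * (2 + ρ)) ∧ ∀ z v : E3, inner ℝ (fderiv ℝ V z v) v ≤ s * ‖v‖ ^ 2) ∨
  (∃ θ : ℝ, θ < 2 + ρ ∧
    (∀ P' : E3 → ℝ, Literature.Analysis.FluidPDE.IsSelfSimilarEulerProfile (1 / (2 + ρ)) 0 V P' →
      ∃ C : ℝ, ∀ r : ℝ, 1 ≤ r → ∀ y y' : E3, ‖y‖ ≤ r → ‖y'‖ ≤ r →
        Literature.Analysis.FluidPDE.selfSimilarBernoulli (1 / (2 + ρ)) 0 V P' y - Literature.Analysis.FluidPDE.selfSimilarBernoulli (1 / (2 + ρ)) 0 V P' y' ≤ C * r ^ θ) ∧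
    ∀ c' : ℝ, 0 < c' → ∀ x₀ : E3, Literature.Analysis.FluidPDE.curl V x₀ ≠ 0 → ∃ r : ℝ, 0 < r ∧ ∃ R₀ : ℝ,
      ∀ R : ℝ, R₀ ≤ R → ∀ (V' : E3 → E3) (K Rbig : ℝ), ContDiff ℝ 2 V' →
        (∀ y, ‖fderiv ℝ V' y‖ ≤ K) → 2 * R < Rbig → (∀ w ∈ Metric.ball (0 : E3) Rbig, V' w = V w) →
        (volume (Metric.ball x₀ r ∩ {a | ∀ σ ∈ Set.Icc 0 (c' * R ^ (2 + ρ)), ‖Literature.Analysis.ODE.evolutionMap (fun _ : ℝ => Literature.Analysis.FluidPDE.selfSimilarTransport (1 / (2 + ρ)) 0 V') 0 (-σ) a‖ ≤ 2 * R} ∩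
          {a | c' * R ^ (2 + ρ) / 2 ≤ (volume {σ ∈ Set.Icc 0 (c' * R ^ (2 + ρ)) |
            ‖Literature.Analysis.FluidPDE.selfSimilarTransport (1 / (2 + ρ)) 0 V' (Literature.Analysis.ODE.evolutionMap (fun _ : ℝ => Literature.Analysis.FluidPDE.selfSimilarTransport (1 / (2 + ρ)) 0 V') 0 (-σ) a)‖ < R ^ (-((2 + ρ - θ) / 4))}).toReal})).toReal ≤
          (volume (Metric.ball x₀ r)).toReal / 4) ∨
  (∀ c' : ℝ, 0 < c' → ∃ x₀ : E3, ∃ r : ℝ, 0 < r ∧ ∃ R₀ : ℝ, ∀ R : ℝ, R₀ ≤ R →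
      ∀ (V' : E3 → E3) (K Rbig : ℝ), ContDiff ℝ 2 V' → (∀ y, ‖fderiv ℝ V' y‖ ≤ K) → 2 * R < Rbig →
        (∀ w ∈ Metric.ball (0 : E3) Rbig, V' w = V w) →
        (volume (Metric.ball x₀ r ∩ {y | ∀ σ ∈ Set.Icc 0 (c' * R ^ (2 + ρ)),
          ‖Literature.Analysis.ODE.evolutionMap (fun _ : ℝ => Literature.Analysis.FluidPDE.selfSimilarTransport (1 / (2 + ρ)) 0 V') 0 (-σ) y‖ ≤ 2 * R})).toReal ≤
          (volume (Metric.ball x₀ r)).toReal / 2) ∨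
  (∃ θ : ℝ, θ < 2 + ρ ∧
    (∀ P' : E3 → ℝ, Literature.Analysis.FluidPDE.IsSelfSimilarEulerProfile (1 / (2 + ρ)) 0 V P' →
      ∃ C : ℝ, ∀ r : ℝ, 1 ≤ r → ∀ y y' : E3, ‖y‖ ≤ r → ‖y'‖ ≤ r →
        Literature.Analysis.FluidPDE.selfSimilarBernoulli (1 / (2 + ρ)) 0 V P' y - Literature.Analysis.FluidPDE.selfSimilarBernoulli (1 / (2 + ρ)) 0 V P' y' ≤ C * r ^ θ) ∧
    ∀ c' : ℝ, 0 < c' → ∃ x₀ : E3, ∃ r : ℝ, 0 < r ∧ ∃ R₀ : ℝ,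
      ∀ R : ℝ, R₀ ≤ R → ∀ (V' : E3 → E3) (K Rbig : ℝ), ContDiff ℝ 2 V' →
        (∀ y, ‖fderiv ℝ V' y‖ ≤ K) → 2 * R < Rbig → (∀ w ∈ Metric.ball (0 : E3) Rbig, V' w = V w) →
        (volume (Metric.ball x₀ r ∩ {a | ∀ σ ∈ Set.Icc 0 (c' * R ^ (2 + ρ)), ‖Literature.Analysis.ODE.evolutionMap (fun _ : ℝ => Literature.Analysis.FluidPDE.selfSimilarTransport (1 / (2 + ρ)) 0 V') 0 (-σ) a‖ ≤ 2 * R} ∩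
          {a | c' * R ^ (2 + ρ) / 2 ≤ (volume {σ ∈ Set.Icc 0 (c' * R ^ (2 + ρ)) |
            ‖Literature.Analysis.FluidPDE.selfSimilarTransport (1 / (2 + ρ)) 0 V' (Literature.Analysis.ODE.evolutionMap (fun _ : ℝ => Literature.Analysis.FluidPDE.selfSimilarTransport (1 / (2 + ρ)) 0 V') 0 (-σ) a)‖ < R ^ (-((2 + ρ - θ) / 4))}).toReal})).toReal ≤
          (volume (Metric.ball x₀ r)).toReal / 4) ∨
  (∀ P' : E3 → ℝ, Literature.Analysis.FluidPDE.IsSelfSimilarEulerProfile (1 / (2 + ρ)) 0 V P' →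
      ∃ x₁ : E3, Literature.Analysis.FluidPDE.curl V x₁ ≠ 0 ∧ ∃ h : ℝ, h < Literature.Analysis.FluidPDE.selfSimilarBernoulli (1 / (2 + ρ)) 0 V P' x₁ ∧
        (∃ R₀ : ℝ, ∀ y : E3, R₀ ≤ ‖y‖ → h < Literature.Analysis.FluidPDE.selfSimilarBernoulli (1 / (2 + ρ)) 0 V P' y → Literature.Analysis.FluidPDE.curl V y ≠ 0 →
          inner ℝ y (Literature.Analysis.FluidPDE.selfSimilarTransport (1 / (2 + ρ)) 0 V y) = 0 →
          0 < ‖Literature.Analysis.FluidPDE.selfSimilarTransport (1 / (2 + ρ)) 0 V y‖ ^ 2 + (1 / (2 + ρ)) * inner ℝ y (Literature.Analysis.FluidPDE.selfSimilarTransport (1 / (2 + ρ)) 0 V y) +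
            inner ℝ y (fderiv ℝ V y (Literature.Analysis.FluidPDE.selfSimilarTransport (1 / (2 + ρ)) 0 V y))) ∧
        (∃ w₀ : ℝ, 0 < w₀ ∧ ∃ R₀ : ℝ, ∀ y : E3, R₀ ≤ ‖y‖ → h < Literature.Analysis.FluidPDE.selfSimilarBernoulli (1 / (2 + ρ)) 0 V P' y → Literature.Analysis.FluidPDE.curl V y ≠ 0 →
          inner ℝ y (Literature.Analysis.FluidPDE.selfSimilarTransport (1 / (2 + ρ)) 0 V y) ≤ 0 → w₀ ≤ ‖Literature.Analysis.FluidPDE.selfSimilarTransport (1 / (2 + ρ)) 0 V y‖) ∧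
        (∃ C θ R₀ : ℝ, θ < 2 + ρ ∧ ∀ (r : ℝ) (y y' : E3), R₀ ≤ ‖y‖ → ‖y‖ ≤ r → R₀ ≤ ‖y'‖ → ‖y'‖ ≤ r →
          h < Literature.Analysis.FluidPDE.selfSimilarBernoulli (1 / (2 + ρ)) 0 V P' y → Literature.Analysis.FluidPDE.curl V y ≠ 0 → h < Literature.Analysis.FluidPDE.selfSimilarBernoulli (1 / (2 + ρ)) 0 V P' y' → Literature.Analysis.FluidPDE.curl V y' ≠ 0 →
          Literature.Analysis.FluidPDE.selfSimilarBernoulli (1 / (2 + ρ)) 0 V P' y - Literature.Analysis.FluidPDE.selfSimilarBernoulli (1 / (2 + ρ)) 0 V P' y' ≤ C * r ^ θ)) ∨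
  (∀ P' : E3 → ℝ, Literature.Analysis.FluidPDE.IsSelfSimilarEulerProfile (1 / (2 + ρ)) 0 V P' →
      ∃ x₀ : E3, Literature.Analysis.FluidPDE.curl V x₀ ≠ 0 ∧ ∃ h : ℝ, h < Literature.Analysis.FluidPDE.selfSimilarBernoulli (1 / (2 + ρ)) 0 V P' x₀ ∧
        (∃ w₀ R₁ : ℝ, 0 < w₀ ∧ ∀ y : E3, R₁ ≤ ‖y‖ →
          h < Literature.Analysis.FluidPDE.selfSimilarBernoulli (1 / (2 + ρ)) 0 V P' y → Literature.Analysis.FluidPDE.curl V y ≠ 0 →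
            w₀ ≤ ‖Literature.Analysis.FluidPDE.selfSimilarTransport (1 / (2 + ρ)) 0 V y‖) ∧
        ∃ C θ : ℝ, θ < 2 + ρ ∧ ∀ R : ℝ, 1 ≤ R → ∀ z : E3, ‖z‖ ≤ 2 * R → Literature.Analysis.FluidPDE.curl V z ≠ 0 →
          h < Literature.Analysis.FluidPDE.selfSimilarBernoulli (1 / (2 + ρ)) 0 V P' z →
            Literature.Analysis.FluidPDE.selfSimilarBernoulli (1 / (2 + ρ)) 0 V P' z ≤ h + C * R ^ θ)

/-- Bounded vortical Bernoulli levels + unpressurised vortical far field (verbatim `Birth.HasVorticalBernoulliBound`, v52/v78). -/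
@[reducible] def HasVorticalBernoulliBound (ρ : ℝ) (V : E3 → E3) : Prop :=
  ∀ P' : E3 → ℝ, Literature.Analysis.FluidPDE.IsSelfSimilarEulerProfile (1 / (2 + ρ)) 0 V P' →
    (∃ Mb : ℝ, ∀ y : E3, Literature.Analysis.FluidPDE.curl V y ≠ 0 →
        Literature.Analysis.FluidPDE.selfSimilarBernoulli (1 / (2 + ρ)) 0 V P' y ≤ Mb) ∧
    (∃ ε R₀ : ℝ, ε < (1 / (2 + ρ)) * (1 - 1 / (2 + ρ)) / 2 ∧
        ∀ y : E3, R₀ ≤ ‖y‖ → Literature.Analysis.FluidPDE.curl V y ≠ 0 → P' y ≤ ε * ‖y‖ ^ 2)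

/-- Tame vortical Bernoulli levels, growth form (verbatim `Birth.HasTameVorticalBernoulli`, v78). -/
@[reducible] def HasTameVorticalBernoulli (ρ : ℝ) (V : E3 → E3) : Prop :=
  HasVorticalBernoulliBound ρ V ∨
    ((∀ P' : E3 → ℝ, Literature.Analysis.FluidPDE.IsSelfSimilarEulerProfile (1 / (2 + ρ)) 0 V P' →
        ∃ Mb : ℝ, ∀ y : E3, Literature.Analysis.FluidPDE.curl V y ≠ 0 → Literature.Analysis.FluidPDE.selfSimilarBernoulli (1 / (2 + ρ)) 0 V P' y ≤ Mb) ∧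
      (∃ A q R₀ : ℝ, 0 ≤ A ∧ 0 ≤ q ∧ q < 2 + 2 * (1 + 2 * ρ) / 3 ∧
        ∀ z : E3, R₀ ≤ ‖z‖ → Literature.Analysis.FluidPDE.frobeniusNormSq (fderiv ℝ V z) - ‖Literature.Analysis.FluidPDE.curl V z‖ ^ 2 ≤ A * ‖z‖ ^ q))

/-- THE ONE STATEMENT — verbatim `Birth.Sig.stub_selfSimilarC2Needle` (`Lines/birth.lean` v78, open stub of the LEAD skeleton); over the verbatim predicate copies above it is definitionally the LEAD's needle (`Iff.rfl` once both files are in scope). -/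
def Sig.stub_selfSimilarC2Needle : Prop :=
  ∀ ρ : ℝ, 0 < ρ → ρ ≤ 1 / 2 →
    ∀ (u : ℝ → E3 → E3) (p : ℝ → E3 → ℝ) (H : ℝ → E3 → E3 →L[ℝ] E3) (c : ℝ≥0) (V : E3 → E3) (P : E3 → ℝ),
      InClass ρ u p H c → IsExactlySelfSimilar ρ u p V P → IsExtremalProfile ρ V → ContDiff ℝ 2 V →
        ¬ HasBernoulliPiercing ρ V → ¬ HasTameVorticalBernoulli ρ V → ¬ HasFastVorticalChannel ρ V → ¬ HasResidenceClock ρ V →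
        ¬ (∃ R : E3 ≃ₗᵢ[ℝ] E3, Literature.Analysis.FluidPDE.IsAxisymmetric (fun y => R (V (R.symm y)))) →
        Function.uncurry u =ᵐ[volume.restrict (Set.Iio (0 : ℝ) ×ˢ (Set.univ : Set E3))] 0


/-- THE NEEDLE DATA: every hypothesis of `Birth.Sig.stub_selfSimilarC2Needle` EXCEPT the channel binder
`¬ HasFastVorticalChannel ρ V`, bundled (verbatim predicates of `Lines/birth.lean` v78). -/
@[reducible] def NeedleData (ρ : ℝ) (u : ℝ → E3 → E3) (p : ℝ → E3 → ℝ) (H : ℝ → E3 → E3 →L[ℝ] E3)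
    (c : ℝ≥0) (V : E3 → E3) (P : E3 → ℝ) : Prop :=
  InClass ρ u p H c ∧ IsExactlySelfSimilar ρ u p V P ∧ IsExtremalProfile ρ V ∧ ContDiff ℝ 2 V ∧
    ¬ HasBernoulliPiercing ρ V ∧ ¬ HasTameVorticalBernoulli ρ V ∧ ¬ HasResidenceClock ρ V ∧
    ¬ (∃ R : E3 ≃ₗᵢ[ℝ] E3, Literature.Analysis.FluidPDE.IsAxisymmetric (fun y => R (V (R.symm y))))


/-! ## Lamb calculus of the Bernoulli form (CLOSED, class-free, 0 sorry) -/
namespace Lamb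

open Literature.Analysis Literature.Analysis.FluidPDE InnerProductSpace
open scoped RealInnerProductSpace

variable {γ : ℝ} {V : EuclideanSpace ℝ (Fin 3) → EuclideanSpace ℝ (Fin 3)} {P : EuclideanSpace ℝ (Fin 3) → ℝ}

/-- `⟪a × b, b⟫ = 0`. [folklore] -/
theorem inner_cross_self_right (a b : EuclideanSpace ℝ (Fin 3)) : ⟪cross a b, b⟫ = 0 := by
  simp only [cross, EuclideanSpace.inner_eq_star_dotProduct, star_trivial]
  simp [dot_cross_self]

/-- `‖a × b‖ ≤ ‖a‖‖b‖`. [folklore] -/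
theorem norm_cross_le (a b : EuclideanSpace ℝ (Fin 3)) : ‖cross a b‖ ≤ ‖a‖ * ‖b‖ := by
  rw [norm_cross]
  have h1 : Real.sin (InnerProductGeometry.angle a b) ≤ 1 := Real.sin_le_one _
  have h0 : 0 ≤ ‖a‖ * ‖b‖ := by positivity
  nlinarith

/-- **Pythagoras for the Bernoulli form**: `‖∇ℋ(y)‖² = (1−2γ)²‖W(y)‖² + ‖Ω(y) × W(y)‖²` for every profile of CIV (3.3)
(`∇ℋ = (2γ−1)W − Ω × W` and `Ω × W ⊥ W`). [cite: ConstantinIgnatovaVicol2026Putative, §3.4.3 (3.29)] -/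
theorem sq_norm_gradient_eq (hprof : IsSelfSimilarEulerProfile γ 0 V P) (y : EuclideanSpace ℝ (Fin 3)) :
    ‖gradient (selfSimilarBernoulli γ 0 V P) y‖ ^ 2 =
      (1 - 2 * γ) ^ 2 * ‖selfSimilarTransport γ 0 V y‖ ^ 2 +
        ‖cross (curl V y) (selfSimilarTransport γ 0 V y)‖ ^ 2 := by
  rw [hprof.gradient_selfSimilarBernoulli y]
  set W := selfSimilarTransport γ 0 V y
  set C := cross (curl V y) W
  have hC : ⟪C, W⟫ = 0 := inner_cross_self_right _ _
  have e : ‖(2 * γ - 1) • W - C‖ ^ 2 = ‖(2 * γ - 1) • W‖ ^ 2 - 2 * ⟪(2 * γ - 1) • W, C⟫ + ‖C‖ ^ 2 :=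
    norm_sub_sq_real _ _
  have hC' : ⟪(2 * γ - 1) • W, C⟫ = 0 := by
    rw [real_inner_comm, inner_smul_right, hC, mul_zero]
  rw [e, hC', mul_zero, sub_zero, norm_smul, mul_pow, Real.norm_eq_abs, sq_abs]
  ring

/-- **NEAR-CRITICAL ⇒ NEAR-STAGNANT**: `(1−2γ)‖W(y)‖ ≤ ‖∇ℋ(y)‖` (`γ ≤ ½`).  An `ε`-critical point of the Bernoulli function
is an `ε/(1−2γ)`-stagnation point of the similarity transport field. [cite: ConstantinIgnatovaVicol2026Putative, §3.4.3 (3.29)] -/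
theorem speed_le_norm_gradient (hprof : IsSelfSimilarEulerProfile γ 0 V P) (hγ : γ ≤ 1 / 2)
    (y : EuclideanSpace ℝ (Fin 3)) :
    (1 - 2 * γ) * ‖selfSimilarTransport γ 0 V y‖ ≤ ‖gradient (selfSimilarBernoulli γ 0 V P) y‖ := by
  have e := sq_norm_gradient_eq hprof y
  have h0 : 0 ≤ (1 - 2 * γ) * ‖selfSimilarTransport γ 0 V y‖ := by
    have : 0 ≤ 1 - 2 * γ := by linarith
    positivity
  have h1 : ((1 - 2 * γ) * ‖selfSimilarTransport γ 0 V y‖) ^ 2 ≤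
      ‖gradient (selfSimilarBernoulli γ 0 V P) y‖ ^ 2 := by
    rw [e, mul_pow]; linarith [sq_nonneg ‖cross (curl V y) (selfSimilarTransport γ 0 V y)‖]
  exact (pow_le_pow_iff_left₀ h0 (norm_nonneg _) two_ne_zero).1 h1

/-- **FLANK VORTICITY FLOOR**: `‖∇ℋ(y)‖ ≤ ‖W(y)‖ · (‖Ω(y)‖ + (1−2γ))` (`γ ≤ ½`): a steep Bernoulli flank crossed at moderate
similarity speed forces large vorticity. [cite: ConstantinIgnatovaVicol2026Putative, §3.4.3 (3.29)] -/
theorem norm_gradient_le (hprof : IsSelfSimilarEulerProfile γ 0 V P) (hγ : γ ≤ 1 / 2) (y : EuclideanSpace ℝ (Fin 3)) :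
    ‖gradient (selfSimilarBernoulli γ 0 V P) y‖ ≤
      ‖selfSimilarTransport γ 0 V y‖ * (‖curl V y‖ + (1 - 2 * γ)) := by
  rw [hprof.gradient_selfSimilarBernoulli y]
  calc ‖(2 * γ - 1) • selfSimilarTransport γ 0 V y - cross (curl V y) (selfSimilarTransport γ 0 V y)‖
      ≤ ‖(2 * γ - 1) • selfSimilarTransport γ 0 V y‖ + ‖cross (curl V y) (selfSimilarTransport γ 0 V y)‖ :=
        norm_sub_le _ _
    _ ≤ (1 - 2 * γ) * ‖selfSimilarTransport γ 0 V y‖ + ‖curl V y‖ * ‖selfSimilarTransport γ 0 V y‖ := by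
        gcongr
        · rw [norm_smul, Real.norm_eq_abs, abs_of_nonpos (by linarith)]; ring_nf; rfl
        · exact norm_cross_le _ _
    _ = ‖selfSimilarTransport γ 0 V y‖ * (‖curl V y‖ + (1 - 2 * γ)) := by ring

end Lamb

/-! ## The stubs of the line -/

/-- Signature of `stub_creepingMaximisers` (PROVABLE, class-free; size L).  `(V, P′)` a `C²` profile of CIV (3.3) at rate
`γ = 1/(2+ρ) ∈ (0, ½)`; `Mb` an upper bound of `ℋ = selfSimilarBernoulli γ 0 V P′` on the vortical set that is APPROACHED by
vortical values (`Mb` = the vortical supremum).  Then for every `δ > 0` and every radius `R₀` there is a vortical point beyond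
`R₀` with `ℋ > Mb − δ` that HOVERS: `‖γy + V y‖ ≤ δ`.  Proof sketch (BY NAME): a vortical `x` with `ℋ(x) > Mb − δ′`
(`δ′ = min(δ, (1−2γ)δ²)/4`); nearby an a.e.-good vortical `x̃` with `ℋ(x̃) > Mb − δ′` (continuity, openness of `{curl ≠ 0}`,
`Loc.ae_not_boundedBackward_of_curl_ne_zero`); its maximal backward orbit `Y` stays vortical (Cauchy formula, as in
`…SelfSimilarBernoulliFeeding`) so `ℋ(Y t) ≤ Mb`, whence by `Loc.bernoulli_comp_sub_eq_of_Ici` the ACTION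
`(1−2γ)∫₀^∞‖W(Y t)‖²dt ≤ δ′` (in particular no finite-time blow-up: `∫‖W(Y)‖ = ∞` on a finite interval would need infinite
action); the orbit is unbounded, and on every excursion beyond `R₀ + 1` of duration `T` and length `≥ 1` one has
`min ‖W‖² ≤ action/T ≤ action²`; so some `Y t` has `R₀ ≤ ‖Y t‖`, `‖W(Y t)‖ ≤ δ`, `ℋ(Y t) ≥ ℋ(x̃) > Mb − δ`, vortical. -/
def Sig.stub_creepingMaximisers : Prop :=
  ∀ ρ : ℝ, 0 < ρ →
    ∀ (V : E3 → E3) (P' : E3 → ℝ), Literature.Analysis.FluidPDE.IsSelfSimilarEulerProfile (1 / (2 + ρ)) 0 V P' →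
      ∀ Mb : ℝ,
        (∀ y : E3, Literature.Analysis.FluidPDE.curl V y ≠ 0 →
            Literature.Analysis.FluidPDE.selfSimilarBernoulli (1 / (2 + ρ)) 0 V P' y ≤ Mb) →
        (∀ δ : ℝ, 0 < δ → ∃ x : E3, Literature.Analysis.FluidPDE.curl V x ≠ 0 ∧
            Mb - δ < Literature.Analysis.FluidPDE.selfSimilarBernoulli (1 / (2 + ρ)) 0 V P' x) →
        ∀ δ : ℝ, 0 < δ → ∀ R₀ : ℝ, ∃ y : E3, R₀ ≤ ‖y‖ ∧ Literature.Analysis.FluidPDE.curl V y ≠ 0 ∧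
          Mb - δ < Literature.Analysis.FluidPDE.selfSimilarBernoulli (1 / (2 + ρ)) 0 V P' y ∧
          ‖Literature.Analysis.FluidPDE.selfSimilarTransport (1 / (2 + ρ)) 0 V y‖ ≤ δ

/-- Signature of `stub_creepFace` (OPEN, size XL — the LEAD's condenser face T-E restricted to NEAR-MAXIMAL labels, with the
action budget as handle): under the needle data and `¬ HasFastVorticalChannel ρ V`, for every classical pressure `P′` and every
upper bound `Mb` of `ℋ_{P′}` on the vortical set there are `δ > 0` and `R₀` such that NO vortical point beyond `R₀` with
`ℋ_{P′} > Mb − δ` hovers (`‖γy + V y‖ ≤ δ`).  Informal: an open far set of labels all of whose backward orbits creep forever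
with action `< δ/(1−2γ)` — `η`-hovering off a time set of measure `δ/((1−2γ)η²)`, carrying stagnation-level pressure
`P′ > Mb − δ − ½δ² + ½γ(1−γ)‖y‖²` (`NeedleFaces.Residue.pressure_gt_of_high_of_hovering`) — is incompatible with the class
budgets.  Why it might fail: the pressurised parked cell of RESIDUE-MEMO §2 T2 / §4 T-E is budget-consistent statically
(`PressureParking.volume_pressurised_le`: `vol ≲ L^{−3−3ρ}` is an upper bound, not a contradiction) and a creeping orbit has
zero capacity; the kill needs the budgets ALONG the creeping filament (high-set flux law (F) `HighSetFlux.flux_exit_law` / `lateral_exit_law` +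
capacity layer (K) `PressureParking.pressure_excess_le_two_scale` / `exists_gradient_spike_near_pressure_excess`) or a clock for near-maximal labels. -/
def Sig.stub_creepFace : Prop :=
  ∀ ρ : ℝ, 0 < ρ → ρ ≤ 1 / 2 →
    ∀ (u : ℝ → E3 → E3) (p : ℝ → E3 → ℝ) (H : ℝ → E3 → E3 →L[ℝ] E3) (c : ℝ≥0) (V : E3 → E3) (P : E3 → ℝ),
      NeedleData ρ u p H c V P → ¬ HasFastVorticalChannel ρ V →
        ∀ P' : E3 → ℝ, Literature.Analysis.FluidPDE.IsSelfSimilarEulerProfile (1 / (2 + ρ)) 0 V P' →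
          ∀ Mb : ℝ,
            (∀ y : E3, Literature.Analysis.FluidPDE.curl V y ≠ 0 →
                Literature.Analysis.FluidPDE.selfSimilarBernoulli (1 / (2 + ρ)) 0 V P' y ≤ Mb) →
            ∃ δ : ℝ, 0 < δ ∧ ∃ R₀ : ℝ, ∀ y : E3, R₀ ≤ ‖y‖ → Literature.Analysis.FluidPDE.curl V y ≠ 0 →
              Mb - δ < Literature.Analysis.FluidPDE.selfSimilarBernoulli (1 / (2 + ρ)) 0 V P' y →
                δ < ‖Literature.Analysis.FluidPDE.selfSimilarTransport (1 / (2 + ρ)) 0 V y‖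

/-- Signature of `stub_creepingFilament` (AC1′ — PROVABLE, class-free, size L; REV2 = the ORBIT form of AC1 asked for by the critic, V84 P2:
«AC1's proof yields far more than its conclusion states»).  Same data as AC1.  Then for every `δ > 0` and every radius `R₀` there is a
CREEPING FILAMENT: a GLOBAL backward similarity half-orbit `Y` (the W3b orbit shape `HasDerivAt Y ((−1)•W(Y t)) t`, `t ≥ 0`) that STARTS
at a vortical point beyond `R₀` with `ℋ > Mb − δ`, is UNBOUNDED, and has TOTAL ACTION `∫₀^T ‖W(Y t)‖² dt ≤ δ` for every `T ≥ 0`.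
Proof (BY NAME, = the proof of `ActionCreep.creepingMaximisers` with the orbit retained): with `δ′ := min(δ, (1−2γ)δ)/2` take the
global unbounded vortical backward orbit `Y` from an a.e.-good near-maximiser `x̃`, `ℋ(x̃) > Mb − δ′` (as there: `Loc.ae_not_boundedBackward_of_curl_ne_zero`,
vorticity transport, `Loc.bernoulli_comp_sub_eq_of_Ici` ⇒ `(1−2γ)·action ≤ Mb − ℋ(x̃) < δ′`, no finite-time escape); pick `t₀` with
`‖Y t₀‖ ≥ R₀` and SHIFT: `Z s := Y (t₀ + s)` is again a global orbit, starts far, is vortical (transport), has `ℋ(Z 0) ≥ ℋ(x̃)` (monotone),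
is unbounded (the image of `[0,t₀]` is bounded) and has action `≤` that of `Y`. -/
def Sig.stub_creepingFilament : Prop :=
  ∀ ρ : ℝ, 0 < ρ →
    ∀ (V : E3 → E3) (P' : E3 → ℝ), Literature.Analysis.FluidPDE.IsSelfSimilarEulerProfile (1 / (2 + ρ)) 0 V P' →
      ∀ Mb : ℝ,
        (∀ y : E3, Literature.Analysis.FluidPDE.curl V y ≠ 0 →
            Literature.Analysis.FluidPDE.selfSimilarBernoulli (1 / (2 + ρ)) 0 V P' y ≤ Mb) →
        (∀ δ : ℝ, 0 < δ → ∃ x : E3, Literature.Analysis.FluidPDE.curl V x ≠ 0 ∧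
            Mb - δ < Literature.Analysis.FluidPDE.selfSimilarBernoulli (1 / (2 + ρ)) 0 V P' x) →
        ∀ δ : ℝ, 0 < δ → ∀ R₀ : ℝ, ∃ Y : ℝ → E3,
          (∀ t : ℝ, 0 ≤ t →
              HasDerivAt Y ((-1 : ℝ) • Literature.Analysis.FluidPDE.selfSimilarTransport (1 / (2 + ρ)) 0 V (Y t)) t) ∧
          R₀ ≤ ‖Y 0‖ ∧ Literature.Analysis.FluidPDE.curl V (Y 0) ≠ 0 ∧
          Mb - δ < Literature.Analysis.FluidPDE.selfSimilarBernoulli (1 / (2 + ρ)) 0 V P' (Y 0) ∧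
          (∀ N : ℝ, ∃ t : ℝ, 0 ≤ t ∧ N < ‖Y t‖) ∧
          (∀ T : ℝ, 0 ≤ T →
              ∫ t in (0 : ℝ)..T, ‖Literature.Analysis.FluidPDE.selfSimilarTransport (1 / (2 + ρ)) 0 V (Y t)‖ ^ 2 ≤ δ)

/-- Signature of `stub_filamentFace` (AC2′ — OPEN, size XL; REV2 = AC2 WEAKENED to forbid CREEPING FILAMENTS instead of single hovering points,
as the critic asked (V84 P2): the forbidden object is now a curve to infinity that the set-integrated laws can act on).  Under the needle data and
`¬ HasFastVorticalChannel ρ V`, for every classical pressure `P′` and every upper bound `Mb` of `ℋ_{P′}` on the vortical set there are `δ > 0`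
and `R₀` such that every GLOBAL backward similarity half-orbit starting at a vortical point beyond `R₀` with `ℋ > Mb − δ` and of total action
`≤ δ` is BOUNDED (equivalently, by W3b/`stub_creepingFilament`, there is none).  Informal content: such a filament is an infinitely long
vortical curve to infinity with square-summable speed, `η`-hovering off a time set of measure `≤ δ/η²`, pinned at the top Bernoulli level
`(Mb − δ, Mb]`, hence carrying stagnation-level pressure `P′ ≥ Mb − δ − ½‖W‖² + ½γ(1−γ)‖Y‖²` along it
(`NeedleFaces.Residue.pressure_gt_of_high_of_hovering`); the tools that integrate ALONG sets — (F) `HighSetFlux.flux_exit_law` /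
`lateral_exit_law`, (K) `PressureParking.pressure_excess_le_two_scale` / `exists_gradient_spike_near_pressure_excess`, the E-gauge on the balls
the filament crosses — are the intended instruments.  Why it might fail: a filament has zero volume; the budgets see it only through the
pressure it forces on neighbourhoods (harmonic-type lower bounds near a pressurised curve), and the pressurised parked cell of RESIDUE-MEMO §2 T2
may be a bounded-branch object (critic V84 P4 — question to the LEAD). -/
def Sig.stub_filamentFace : Prop :=
  ∀ ρ : ℝ, 0 < ρ → ρ ≤ 1 / 2 →
    ∀ (u : ℝ → E3 → E3) (p : ℝ → E3 → ℝ) (H : ℝ → E3 → E3 →L[ℝ] E3) (c : ℝ≥0) (V : E3 → E3) (P : E3 → ℝ),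
      NeedleData ρ u p H c V P → ¬ HasFastVorticalChannel ρ V →
        ∀ P' : E3 → ℝ, Literature.Analysis.FluidPDE.IsSelfSimilarEulerProfile (1 / (2 + ρ)) 0 V P' →
          ∀ Mb : ℝ,
            (∀ y : E3, Literature.Analysis.FluidPDE.curl V y ≠ 0 →
                Literature.Analysis.FluidPDE.selfSimilarBernoulli (1 / (2 + ρ)) 0 V P' y ≤ Mb) →
            ∃ δ : ℝ, 0 < δ ∧ ∃ R₀ : ℝ, ∀ Y : ℝ → E3,
              (∀ t : ℝ, 0 ≤ t →
                  HasDerivAt Y ((-1 : ℝ) • Literature.Analysis.FluidPDE.selfSimilarTransport (1 / (2 + ρ)) 0 V (Y t)) t) →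
              R₀ ≤ ‖Y 0‖ → Literature.Analysis.FluidPDE.curl V (Y 0) ≠ 0 →
              Mb - δ < Literature.Analysis.FluidPDE.selfSimilarBernoulli (1 / (2 + ρ)) 0 V P' (Y 0) →
              (∀ T : ℝ, 0 ≤ T →
                  ∫ t in (0 : ℝ)..T, ‖Literature.Analysis.FluidPDE.selfSimilarTransport (1 / (2 + ρ)) 0 V (Y t)‖ ^ 2 ≤ δ) →
              ∃ N : ℝ, ∀ t : ℝ, 0 ≤ t → ‖Y t‖ ≤ N

/-- Signature of `stub_blazeFace` (OPEN — THE BLAZING NEEDLE ITSELF; NOT attacked by this line, typed so that the composition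
is kernel-checked and the branch point is explicit): under the needle data and `¬ HasFastVorticalChannel ρ V`, for every
classical pressure `P′` the Bernoulli function is bounded above on the vortical set.  Why it might fail: it is the generic
needle — along fast unpressurised inflow jets `ℋ ≈ ½‖W‖² − ½γ(1−γ)R² + P′ ≳ +0.005 R² → +∞` (`‖W‖ ≳ 0.49R`); every known
kill of unbounded levels is a clock or a channel (binders).  Honest label: residual complement, not a face with a mechanism. -/
def Sig.stub_blazeFace : Prop :=
  ∀ ρ : ℝ, 0 < ρ → ρ ≤ 1 / 2 →
    ∀ (u : ℝ → E3 → E3) (p : ℝ → E3 → ℝ) (H : ℝ → E3 → E3 →L[ℝ] E3) (c : ℝ≥0) (V : E3 → E3) (P : E3 → ℝ),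
      NeedleData ρ u p H c V P → ¬ HasFastVorticalChannel ρ V →
        ∀ P' : E3 → ℝ, Literature.Analysis.FluidPDE.IsSelfSimilarEulerProfile (1 / (2 + ρ)) 0 V P' →
          ∃ Mb : ℝ, ∀ y : E3, Literature.Analysis.FluidPDE.curl V y ≠ 0 →
            Literature.Analysis.FluidPDE.selfSimilarBernoulli (1 / (2 + ρ)) 0 V P' y ≤ Mb

/-- «THE BOUNDED BRANCH» as one statement (intermediate, for the record): needle data + `¬ channel` + ONE classical pressure with
bounded vortical Bernoulli levels ⇒ trivial. -/
def Sig.boundedBranch : Prop :=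
  ∀ ρ : ℝ, 0 < ρ → ρ ≤ 1 / 2 →
    ∀ (u : ℝ → E3 → E3) (p : ℝ → E3 → ℝ) (H : ℝ → E3 → E3 →L[ℝ] E3) (c : ℝ≥0) (V : E3 → E3) (P : E3 → ℝ),
      NeedleData ρ u p H c V P → ¬ HasFastVorticalChannel ρ V →
        ∀ P' : E3 → ℝ, Literature.Analysis.FluidPDE.IsSelfSimilarEulerProfile (1 / (2 + ρ)) 0 V P' →
          ∀ Mb : ℝ,
            (∀ y : E3, Literature.Analysis.FluidPDE.curl V y ≠ 0 →
                Literature.Analysis.FluidPDE.selfSimilarBernoulli (1 / (2 + ρ)) 0 V P' y ≤ Mb) →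
            (∃ x : E3, Literature.Analysis.FluidPDE.curl V x ≠ 0) →
              Function.uncurry u =ᵐ[volume.restrict (Set.Iio (0 : ℝ) ×ˢ (Set.univ : Set E3))] 0

/-- CLOSED (REV1): AC1 is the tree theorem `ActionCreep.creepingMaximisers` (ns-ezl-w3 g6, p680489), the Sig VERBATIM. -/
theorem stub_creepingMaximisers : Sig.stub_creepingMaximisers :=
  Summit.NavierStokesRegularity.NavierStokesRegularity.Theorems.PowerGaugeEulerLiouville.ActionCreep.creepingMaximisers

/-- CLOSED (REV3): AC1′ is the tree theorem `ActionCreep.creepingFilament` (ns-ezl-w3 g6, p683438), the Sig VERBATIM (was PROVABLE L, REV2). -/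
theorem stub_creepingFilament : Sig.stub_creepingFilament :=
  Summit.NavierStokesRegularity.NavierStokesRegularity.Theorems.PowerGaugeEulerLiouville.ActionCreep.creepingFilament

/-- OPEN (XL): AC2′, no creeping filaments (REV2; replaces the REV0 stub `stub_creepFace`, whose Sig is kept for the record and
still feeds the REV0 composition `selfSimilarC2Needle_of` as a hypothesis). -/
theorem stub_filamentFace : Sig.stub_filamentFace := by
  sorry

/-- OPEN: the blazing needle (residual complement; not attacked here). -/
theorem stub_blazeFace : Sig.stub_blazeFace := by
  sorry

/-! ## Compositions (kernel-checked, no sorry) -/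

/-- The bounded branch closes from `stub_creepingMaximisers` + `stub_creepFace`: with `M := sSup` of the vortical Bernoulli
values (a bound that is approached), the creeping maximiser beyond `R₀` at tolerance `δ` contradicts the face. -/
theorem boundedBranch_of (hC : Sig.stub_creepingMaximisers) (hF : Sig.stub_creepFace) : Sig.boundedBranch := by
  intro ρ hρ hρ' u p H c V P hD hnch P' hP' Mb hMb hne
  -- the vortical supremum
  set S : Set ℝ := (fun y => Literature.Analysis.FluidPDE.selfSimilarBernoulli (1 / (2 + ρ)) 0 V P' y) ''
    {y : E3 | Literature.Analysis.FluidPDE.curl V y ≠ 0} with hS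
  have hSne : S.Nonempty := by
    obtain ⟨x, hx⟩ := hne
    exact ⟨_, x, hx, rfl⟩
  have hSbdd : BddAbove S := by
    refine ⟨Mb, ?_⟩
    rintro _ ⟨y, hy, rfl⟩
    exact hMb y hy
  set M : ℝ := sSup S with hM
  have hMub : ∀ y : E3, Literature.Analysis.FluidPDE.curl V y ≠ 0 →
      Literature.Analysis.FluidPDE.selfSimilarBernoulli (1 / (2 + ρ)) 0 V P' y ≤ M :=
    fun y hy => le_csSup hSbdd ⟨y, hy, rfl⟩
  have hMapp : ∀ δ : ℝ, 0 < δ → ∃ x : E3, Literature.Analysis.FluidPDE.curl V x ≠ 0 ∧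
      M - δ < Literature.Analysis.FluidPDE.selfSimilarBernoulli (1 / (2 + ρ)) 0 V P' x := by
    intro δ hδ
    obtain ⟨_, ⟨x, hx, rfl⟩, hlt⟩ := exists_lt_of_lt_csSup hSne (by linarith : M - δ < M)
    exact ⟨x, hx, hlt⟩
  obtain ⟨δ, hδ, R₀, hR₀⟩ := hF ρ hρ hρ' u p H c V P hD hnch P' hP' M hMub
  obtain ⟨y, hy, hcurl, hhigh, hslow⟩ := hC ρ hρ V P' hP' M hMub hMapp δ hδ R₀
  exact absurd hslow (not_le.mpr (hR₀ y hy hcurl hhigh))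

/-- THE ONE STATEMENT from the three stubs (pure logic + the vortical supremum): `¬ HasBernoulliPiercing` supplies a classical
pressure `P′` and a vortical point; `stub_blazeFace` puts the profile in the bounded branch; `boundedBranch_of` closes it. -/
theorem selfSimilarC2Needle_of (hC : Sig.stub_creepingMaximisers) (hF : Sig.stub_creepFace) (hB : Sig.stub_blazeFace) :
    Sig.stub_selfSimilarC2Needle := by
  intro ρ hρ hρ' u p H c V P hcls hss hext hC2 hnp hntame hnch hnclock hnaxis
  have hD : NeedleData ρ u p H c V P := ⟨hcls, hss, hext, hC2, hnp, hntame, hnclock, hnaxis⟩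
  -- a classical pressure and a vortical point, from `¬ HasBernoulliPiercing`
  have hnp' := hnp
  simp only [HasBernoulliPiercing, not_forall, not_exists, not_and, not_or, not_lt] at hnp'
  obtain ⟨P', hP', h, R₁, hpierce⟩ := hnp'
  obtain ⟨Mb, hMb⟩ := hB ρ hρ hρ' u p H c V P hD hnch P' hP'
  have hne : ∃ x : E3, Literature.Analysis.FluidPDE.curl V x ≠ 0 := by
    obtain ⟨y, hyR, hyin, hcurl, _⟩ := hpierce R₁ le_rfl
    exact ⟨y, hcurl⟩
  exact boundedBranch_of hC hF ρ hρ hρ' u p H c V P hD hnch P' hP' Mb hMb hne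


/-! ## REV2 compositions through the filament forms (kernel-checked, no sorry) -/

/-- The bounded branch closes from AC1′ + AC2′: at the vortical supremum `M`, the face gives `δ, R₀` such that every far high
small-action global orbit is bounded; AC1′ gives one that is unbounded. -/
theorem boundedBranch_of_filament (hC : Sig.stub_creepingFilament) (hF : Sig.stub_filamentFace) : Sig.boundedBranch := by
  intro ρ hρ hρ' u p H c V P hD hnch P' hP' Mb hMb hne
  set S : Set ℝ := (fun y => Literature.Analysis.FluidPDE.selfSimilarBernoulli (1 / (2 + ρ)) 0 V P' y) ''
    {y : E3 | Literature.Analysis.FluidPDE.curl V y ≠ 0} with hS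
  have hSne : S.Nonempty := by
    obtain ⟨x, hx⟩ := hne
    exact ⟨_, x, hx, rfl⟩
  have hSbdd : BddAbove S := by
    refine ⟨Mb, ?_⟩
    rintro _ ⟨y, hy, rfl⟩
    exact hMb y hy
  set M : ℝ := sSup S with hM
  have hMub : ∀ y : E3, Literature.Analysis.FluidPDE.curl V y ≠ 0 →
      Literature.Analysis.FluidPDE.selfSimilarBernoulli (1 / (2 + ρ)) 0 V P' y ≤ M :=
    fun y hy => le_csSup hSbdd ⟨y, hy, rfl⟩
  have hMapp : ∀ δ : ℝ, 0 < δ → ∃ x : E3, Literature.Analysis.FluidPDE.curl V x ≠ 0 ∧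
      M - δ < Literature.Analysis.FluidPDE.selfSimilarBernoulli (1 / (2 + ρ)) 0 V P' x := by
    intro δ hδ
    obtain ⟨_, ⟨x, hx, rfl⟩, hlt⟩ := exists_lt_of_lt_csSup hSne (by linarith : M - δ < M)
    exact ⟨x, hx, hlt⟩
  obtain ⟨δ, hδ, R₀, hR₀⟩ := hF ρ hρ hρ' u p H c V P hD hnch P' hP' M hMub
  obtain ⟨Y, horb, hfar, hcurl, hhigh, hunb, hact⟩ := hC ρ hρ V P' hP' M hMub hMapp δ hδ R₀
  obtain ⟨N, hN⟩ := hR₀ Y horb hfar hcurl hhigh hact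
  obtain ⟨t, ht, hlt⟩ := hunb N
  exact absurd (hN t ht) (not_le.mpr hlt)

/-- THE ONE STATEMENT from AC1′ + AC2′ + AC3 (REV2 composition; pure logic + the vortical supremum). -/
theorem selfSimilarC2Needle_of_filament (hC : Sig.stub_creepingFilament) (hF : Sig.stub_filamentFace)
    (hB : Sig.stub_blazeFace) : Sig.stub_selfSimilarC2Needle := by
  intro ρ hρ hρ' u p H c V P hcls hss hext hC2 hnp hntame hnch hnclock hnaxis
  have hD : NeedleData ρ u p H c V P := ⟨hcls, hss, hext, hC2, hnp, hntame, hnclock, hnaxis⟩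
  have hnp' := hnp
  simp only [HasBernoulliPiercing, not_forall, not_exists, not_and, not_or, not_lt] at hnp'
  obtain ⟨P', hP', h, R₁, hpierce⟩ := hnp'
  obtain ⟨Mb, hMb⟩ := hB ρ hρ hρ' u p H c V P hD hnch P' hP'
  have hne : ∃ x : E3, Literature.Analysis.FluidPDE.curl V x ≠ 0 := by
    obtain ⟨y, hyR, hyin, hcurl, _⟩ := hpierce R₁ le_rfl
    exact ⟨y, hcurl⟩
  exact boundedBranch_of_filament hC hF ρ hρ hρ' u p H c V P hD hnch P' hP' Mb hMb hne


end Summit.NavierStokesRegularity.NavierStokesRegularity.Cruxes.PowerGaugeEulerLiouville.ActionCreep
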